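import Summits.HodgeConjecture.HodgeConjecture.Theorems.F0P3cStCharTSCartanFinTwo     -- ★ `cartanEllH`, the `H_v` carriers, ★ `CartanEllH` (`exists_isLocalGRegular`), ★ `CartanEllProd` (product plumbing)
import Summits.HodgeConjecture.HodgeConjecture.Theorems.F0P3cStCharTSCartanAll        -- ★ rank-3 model road (brings ★ WeylHypCM ∕ WeylHypFibre (A1) ∕ TorusRay ∕ CartanFields ∕ CartanEllProd)
import Literature.NumberTheory.Rogawski1990.EndoscopicLeviTorusTransport              -- ★ `isLocalGRegular_of_fst_eq_glDiagonal`, `finGammaTwo_eq_of_endoEmbLocal_eq`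
import HarnessLib

/-!
# F0 · P3c · ROAD «UP-TR» (H1) — «CARTAN-SPLIT-H★»: the split Cartan subgroup `M_H = M₂ × U(Φ₁)(L⁺_v)` of the endoscopic group
# `H_v = U(Φ₂)(L⁺_v) × U(Φ₁)(L⁺_v)` is the centraliser of a `G`-regular element, and is NOT compact [Rogawski1990, §3.6 pp. 28–31; §12.5 pp. 182–184]

Cell `pub/hodgecm-mathlib`, crux H413 = `stmt-HodgeConjecture-24833` (lane `--supports … --as helper`), route HCCMUnconditional; ROAD «UP-TR» (LEAD T14-21 «A»,
holder ∕ dealer F0P3-p02 (g23)), brick (H1) «CARTAN-ALL-H», FILE F-A of the census `F0/P3a/F0P3a-p03/g26/h1/CENSUS-H1-CartanAllH.v1.F0P3ap03g26.md`; seat F0P3a-p03 (g26).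
THEOREMS ONLY (no definition ∕ instance ∕ notation ∕ named fact ∕ `sorry`); ★-only imports.

WHAT.  `H₂ = U(Φ₂)(L⁺_v) = (cmDatum L 2 Φ₂).Local v` (definitionally the subtype group `↥(unitaryGroupOfForm (c ⊗ 1) (cmLocalForm L 2 v))`, ★ `cmDatum_Local_eq`),
`H₁ = U(Φ₁)(L⁺_v)`, `M₂ = (cmBorelTriple L 2 v).M = torusU` the diagonal torus `{diag(α, σ(α)⁻¹)}` of `H₂`, `M_H := M₂ × H₁` (the subgroup `M₂.prod ⊤`).  At a finite place
`v` of `L⁺` NON-SPLIT in the CM field `L` (`hns`):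
* §1 `exists_mem_splitTorus_two` — for every unit `u ∈ E_vˣ` the element `diag(u, σ(u)⁻¹)` of `M₂` (as an `∃`, theorems-only), with its two `torusEntry` coordinates.
* §2 **`exists_isLocalGRegular_centralizer_eq_splitTorusH`** — (t1) of the census: `M_H = Z_H(γ₀)` for the `G`-REGULAR `γ₀ = (diag(ϖ, σ(ϖ)⁻¹), 1)` (`ϖ` a uniformiser at the
  place `w ∣ v`: the three eigenvalues `ϖ, 1, σ(ϖ)⁻¹` of `ι_v(γ₀)` have valuations `exp(−1), 1, exp(1)`, so pairwise unit differences, ★ `isLocalGRegular_of_fst_eq_glDiagonal`;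
  `Z_{H₂}(diag) = M₂` by ★ (A1) `centralizer_eq_torusU_of_isRegularElt`; `Z_{H₂ × H₁}((a, b)) = Z_{H₂}(a) × H₁` by ★ `centralizer_singleton_prod_eq_prod_top`).
* §3 **`not_isCompact_splitTorus_two`** — (t3): `M₂` is not compact (the elements `diag(ϖ⁻ⁿ, σ(ϖ)ⁿ)` have `|d₀|_w = q^n → ∞` along the continuous coordinate
  `t ↦ |(t₀₀)_w|_w`; model ★ `F0P3cStCharTSCartanFields.not_isCompact_cmTorus`); **`not_isCompact_splitTorusH`** — nor is `M_H` (★ `isCompact_coe_prod_top_iff`);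
  `not_conj_splitTorusH_of_isCompact` — a compact subgroup of `H_v` is not conjugate to `M_H` (★ `isCompact_coe_map_conj_iff`).
These are two of the three rank-2 twins the (H1) head `exists_cartanAllH` needs (census §2 (t1)(t3)); the third, (t2) «a non-compact Cartan subgroup of `H₂` is conjugate
to `M₂`», is FILES F-B∕F-C.
HONEST LABEL: count-neutral; block consequents 11 → 10 → 9 only at the rider editions; organs 2 = 2; h413 registry untouched; HC_CM is proved only modulo the printed
citations until rung 0 closes.

## References
* [Rogawski1990] J. D. Rogawski, *Automorphic Representations of Unitary Groups in Three Variables*, Ann. of Math. Stud. 123 (1990): §3.6 pp. 28–31 (Cartan subgroups of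
  `U(2)`, `U(2) × U(1)` and `U(3)`: the split torus and the compact ones), §4.3 p. 42 (`G`-regular elements of `H`), §12.5 pp. 182–184.
* [PlatonovRapinchuk1994] V. Platonov, A. Rapinchuk, *Algebraic Groups and Number Theory* (1994), §3.3 (split tori over local fields are not compact), §6.4.
-/

set_option autoImplicit false
-- the mandated namespace has the single-problem summit's repeated segment (`HodgeConjecture.HodgeConjecture`)
set_option linter.dupNamespace false

noncomputable section

open NumberField IsDedekindDomain Filter Topology Matrix Polynomial
open scoped NNReal
open scoped Matrix MatrixGroups
open Literature.NumberTheory.Rogawski1990 Literature.NumberTheory.Automorphic Literature.NumberTheory.Automorphic.UnitaryGroup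
open Literature.NumberTheory.GaloisRepresentations Literature.NumberTheory.GaloisRepresentations.IsNonarchimedeanLocalField
open Summit.HodgeConjecture.HodgeConjecture.Cruxes.H413.F0P3cStCharTSCartanEllProd
open Summit.HodgeConjecture.HodgeConjecture.Cruxes.H413.F0P3cStCharTSCartanEllH (exists_isLocalGRegular)

namespace Summit.HodgeConjecture.HodgeConjecture.Cruxes.H413.F0P3cStCharTSCartanSplitTwoH

variable (L : Type) [Field L] [NumberField L] [IsCMField L] (v : HeightOneSpectrum (𝓞 ↥(maximalRealSubfield L)))

/-! ## §1 The elements `diag(u, σ(u)⁻¹)` of the split torus `M₂` of `U(Φ₂)(L⁺_v)` -/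

/-- **`diag(u, σ(u)⁻¹) ∈ U(Φ₂)(L⁺_v)`** for every unit `u` of `E_v = ∏_{w ∣ v} L_w` (the torus relations `σ(d₁) d₀ = σ(d₀) d₁ = 1` of ★
`glDiagonal_mem_unitaryGroupOfForm_antidiagonal_iff` at `N = 2`). [cite: Rogawski1990, §1.10 p. 9; §3.6 p. 28] -/
theorem glDiagonal_two_mem (u : (LocalRing L v)ˣ) :
    glDiagonal 2 (LocalRing L v)
        ![u, (Units.map ((conjLocal L (IsCMField.complexConj L) v : LocalRing L v →+* LocalRing L v) : LocalRing L v →* LocalRing L v) u)⁻¹] ∈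
      unitaryGroupOfForm (conjLocal L (IsCMField.complexConj L) v) (cmLocalForm L 2 v) := by
  set σu : (LocalRing L v)ˣ →* (LocalRing L v)ˣ :=
    Units.map ((conjLocal L (IsCMField.complexConj L) v : LocalRing L v →+* LocalRing L v) : LocalRing L v →* LocalRing L v) with hσu
  have hcoe : ∀ x : (LocalRing L v)ˣ, conjLocal L (IsCMField.complexConj L) v (x : LocalRing L v) = ((σu x : (LocalRing L v)ˣ) : LocalRing L v) :=
    fun x => by rw [hσu, Units.coe_map, MonoidHom.coe_coe]
  have hσσ : ∀ x : (LocalRing L v)ˣ, σu (σu x) = x := fun x => by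
    apply Units.ext
    rw [hσu, Units.coe_map, Units.coe_map, MonoidHom.coe_coe, conjLocal_conjLocal_cm L v]
  rw [cmLocalForm_eq_over, glDiagonal_mem_unitaryGroupOfForm_antidiagonal_iff]
  intro i
  fin_cases i
  · -- `σ(d₁) d₀ = σ(σ(u)⁻¹) u = u⁻¹ u = 1`
    show conjLocal L (IsCMField.complexConj L) v (((![u, (σu u)⁻¹] : Fin 2 → (LocalRing L v)ˣ) (Fin.rev 0) : (LocalRing L v)ˣ) : LocalRing L v) *
      (((![u, (σu u)⁻¹] : Fin 2 → (LocalRing L v)ˣ) 0 : (LocalRing L v)ˣ) : LocalRing L v) = 1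
    have hrev : (Fin.rev 0 : Fin 2) = 1 := by decide
    rw [hrev]
    simp only [Matrix.cons_val_one, Matrix.cons_val_zero, Matrix.cons_val_fin_one]
    rw [hcoe, map_inv, hσσ, ← Units.val_mul, inv_mul_cancel, Units.val_one]
  · -- `σ(d₀) d₁ = σ(u) σ(u)⁻¹ = 1`
    show conjLocal L (IsCMField.complexConj L) v (((![u, (σu u)⁻¹] : Fin 2 → (LocalRing L v)ˣ) (Fin.rev 1) : (LocalRing L v)ˣ) : LocalRing L v) *
      (((![u, (σu u)⁻¹] : Fin 2 → (LocalRing L v)ˣ) 1 : (LocalRing L v)ˣ) : LocalRing L v) = 1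
    have hrev : (Fin.rev 1 : Fin 2) = 0 := by decide
    rw [hrev]
    simp only [Matrix.cons_val_one, Matrix.cons_val_zero, Matrix.cons_val_fin_one]
    rw [hcoe, ← Units.val_mul, mul_inv_cancel, Units.val_one]

/-- **The elements of the split torus `M₂`**: for every unit `u ∈ E_vˣ` there is `t ∈ M₂ = (cmBorelTriple L 2 v).M` with underlying matrix `diag(u, σ(u)⁻¹)`, first
coordinate `torusEntry 0 t = u` and second coordinate `σ(u)⁻¹`. [cite: Rogawski1990, §1.10 p. 9; §3.6 p. 28] -/
theorem exists_mem_splitTorus_two (u : (LocalRing L v)ˣ) :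
    ∃ t : ↥(cmBorelTriple L 2 v).M,
      glDiagonal 2 (LocalRing L v)
          ![u, (Units.map ((conjLocal L (IsCMField.complexConj L) v : LocalRing L v →+* LocalRing L v) : LocalRing L v →* LocalRing L v) u)⁻¹] =
        (((t : ↥(unitaryGroupOfForm (conjLocal L (IsCMField.complexConj L) v) (cmLocalForm L 2 v))) : GL (Fin 2) (LocalRing L v))) ∧
      torusEntry (conjLocal L (IsCMField.complexConj L) v) (cmLocalForm L 2 v) 0 t = u ∧
      torusEntry (conjLocal L (IsCMField.complexConj L) v) (cmLocalForm L 2 v) 1 t =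
        (Units.map ((conjLocal L (IsCMField.complexConj L) v : LocalRing L v →+* LocalRing L v) : LocalRing L v →* LocalRing L v) u)⁻¹ := by
  refine ⟨⟨⟨_, glDiagonal_two_mem L v u⟩, (mem_torusU_iff _).2 ⟨_, rfl⟩⟩, rfl, ?_, ?_⟩
  · exact (torusEntry_eq_of_glDiagonal_eq _ _ 0 _ _ rfl).trans (by simp)
  · exact (torusEntry_eq_of_glDiagonal_eq _ _ 1 _ _ rfl).trans (by simp)

/-! ## §2 (t1) `M_H = Z_H(γ₀)` for a `G`-regular `γ₀ ∈ M_H` -/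

/-- `u = 1` for `γ_H = (a, 1)`: the `U(Φ₁)`-coordinate of `(a, 1)` is `1`. [cite: Rogawski1990, §4.9 p. 55] -/
theorem finGammaTwo_one_right (a : (UnitaryGroup.cmDatum L 2 (Matrix.of fun i j : Fin 2 => if i.val + j.val + 1 = 2 then (1 : L) else 0)).Local v) :
    finGammaTwo L v (a, 1) = 1 := by
  have h : ((a, (1 : (UnitaryGroup.cmDatum L 1 (Matrix.of fun i j : Fin 1 => if i.val + j.val + 1 = 1 then (1 : L) else 0)).Local v)).2.val.val :
      Matrix (Fin 1) (Fin 1) (UnitaryGroup.LocalRing L v)) = 1 := rfl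
  unfold finGammaTwo
  rw [h, Matrix.one_apply_eq]

set_option maxHeartbeats 800000 in  -- statement-level `whnf` on the CM carriers
/-- **(t1) «`M_H` IS A CARTAN SUBGROUP OF `H_v`»** (`v` non-split): for a uniformiser unit `ϖ ∈ E_vˣ` the element `γ₀ = (diag(ϖ, σ(ϖ)⁻¹), 1) ∈ M_H` is `G`-REGULAR — the
eigenvalues `ϖ, 1, σ(ϖ)⁻¹` of `ι_v(γ₀) = diag(ϖ, 1, σ(ϖ)⁻¹)` have valuations `exp(−1), 1, exp(1)` at the place `w ∣ v`, so their differences are units (★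
`isLocalGRegular_of_fst_eq_glDiagonal`) — and its centraliser is `Z_H(γ₀) = Z_{H₂}(diag) × H₁ = M₂ × H₁ = M_H` (★ (A1) `centralizer_eq_torusU_of_isRegularElt`, ★
`centralizer_singleton_prod_eq_prod_top`).  The rank-2 twin of ★ `F0P3cStCharTSCartanReps.exists_isRegularElt_centralizer_eq_cmTorus`.
[cite: Rogawski1990, §3.6 pp. 28–31; §4.3 p. 42; §12.5 p. 182] -/
theorem exists_isLocalGRegular_centralizer_eq_splitTorusH (hns : ∀ w : PlacesOver L v, IsCMField.complexConj L • w.1 = w.1) :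
    ∃ γ₀ : (UnitaryGroup.cmDatum L 2 (Matrix.of fun i j : Fin 2 => if i.val + j.val + 1 = 2 then (1 : L) else 0)).Local v ×
        (UnitaryGroup.cmDatum L 1 (Matrix.of fun i j : Fin 1 => if i.val + j.val + 1 = 1 then (1 : L) else 0)).Local v,
      IsLocalGRegular L v γ₀ ∧
      (γ₀.1 : ↥(unitaryGroupOfForm (conjLocal L (IsCMField.complexConj L) v) (cmLocalForm L 2 v))) ∈ (cmBorelTriple L 2 v).M ∧ γ₀.2 = 1 ∧
      Subgroup.centralizer ({γ₀} : Set ((UnitaryGroup.cmDatum L 2 (Matrix.of fun i j : Fin 2 => if i.val + j.val + 1 = 2 then (1 : L) else 0)).Local v ×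
        (UnitaryGroup.cmDatum L 1 (Matrix.of fun i j : Fin 1 => if i.val + j.val + 1 = 1 then (1 : L) else 0)).Local v)) =
        (Subgroup.prod (G := (UnitaryGroup.cmDatum L 2 (Matrix.of fun i j : Fin 2 => if i.val + j.val + 1 = 2 then (1 : L) else 0)).Local v) (N := (UnitaryGroup.cmDatum L 1 (Matrix.of fun i j : Fin 1 => if i.val + j.val + 1 = 1 then (1 : L) else 0)).Local v) (cmBorelTriple L 2 v).M ⊤) := by
  obtain ⟨ϖ, hϖ⟩ := F0P3cStCharTSTorusRay.exists_uniformizer_units L v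
  set σu : (LocalRing L v)ˣ →* (LocalRing L v)ˣ :=
    Units.map ((conjLocal L (IsCMField.complexConj L) v : LocalRing L v →+* LocalRing L v) : LocalRing L v →* LocalRing L v) with hσu
  obtain ⟨t, ht, ht0, ht1⟩ := exists_mem_splitTorus_two L v ϖ
  -- the element `γ₀ = (t, 1)`
  set a₀ : (UnitaryGroup.cmDatum L 2 (Matrix.of fun i j : Fin 2 => if i.val + j.val + 1 = 2 then (1 : L) else 0)).Local v :=
    (t : ↥(unitaryGroupOfForm (conjLocal L (IsCMField.complexConj L) v) (cmLocalForm L 2 v))) with ha₀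
  set γ₀ : (UnitaryGroup.cmDatum L 2 (Matrix.of fun i j : Fin 2 => if i.val + j.val + 1 = 2 then (1 : L) else 0)).Local v ×
      (UnitaryGroup.cmDatum L 1 (Matrix.of fun i j : Fin 1 => if i.val + j.val + 1 = 1 then (1 : L) else 0)).Local v := (a₀, 1) with hγ₀
  have hd' : glDiagonal 2 (LocalRing L v) ![ϖ, (σu ϖ)⁻¹] = (γ₀.1.val : GL (Fin 2) (LocalRing L v)) := ht
  -- valuations of the three eigenvalues of `ι_v(γ₀)`
  have hu1 : (((isUnit_finGammaTwo L v γ₀).unit : (LocalRing L v)ˣ) : LocalRing L v) = 1 := by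
    rw [IsUnit.unit_spec, hγ₀, finGammaTwo_one_right]
  have hval0 : ∀ w : PlacesOver L v, Valued.v (((ϖ : (LocalRing L v)ˣ) : LocalRing L v) w) = WithZero.exp (-1 : ℤ) := hϖ
  have hval2 : ∀ w : PlacesOver L v, Valued.v ((((σu ϖ)⁻¹ : (LocalRing L v)ˣ) : LocalRing L v) w) = WithZero.exp (1 : ℤ) := fun w => by
    have h1 : (((σu ϖ)⁻¹ : (LocalRing L v)ˣ) : LocalRing L v) w = ((((σu ϖ) : (LocalRing L v)ˣ) : LocalRing L v) w)⁻¹ := by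
      have e : (((σu ϖ)⁻¹ : (LocalRing L v)ˣ) : LocalRing L v) w * (((σu ϖ) : (LocalRing L v)ˣ) : LocalRing L v) w = 1 := by
        rw [← Pi.mul_apply, Units.inv_mul, Pi.one_apply]
      exact eq_inv_of_mul_eq_one_left e
    have h2 : (((σu ϖ) : (LocalRing L v)ˣ) : LocalRing L v) = conjLocal L (IsCMField.complexConj L) v (ϖ : LocalRing L v) := by
      rw [hσu, Units.coe_map, MonoidHom.coe_coe]
    rw [h1, h2, map_inv₀, F0P3cStCharTSHyperbolicSet.v_conjLocal_apply_of_nonsplit L v hns, hϖ w, ← WithZero.exp_neg, neg_neg]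
  have hm1 : WithZero.exp (-1 : ℤ) ≠ (1 : WithZero (Multiplicative ℤ)) := by
    rw [← WithZero.exp_zero]; exact fun h => by have := WithZero.exp_injective h; omega
  have hp1 : WithZero.exp (1 : ℤ) ≠ (1 : WithZero (Multiplicative ℤ)) := by
    rw [← WithZero.exp_zero]; exact fun h => by have := WithZero.exp_injective h; omega
  have hmp : WithZero.exp (-1 : ℤ) ≠ WithZero.exp (1 : ℤ) := fun h => by have := WithZero.exp_injective h; omega
  -- pairwise unit differences of the eigenvalue vector `e = (ϖ, 1, σ(ϖ)⁻¹)` of `ι_v(γ₀)`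
  set e : Fin 3 → (LocalRing L v)ˣ :=
    ![(![ϖ, (σu ϖ)⁻¹] : Fin 2 → (LocalRing L v)ˣ) 0, (isUnit_finGammaTwo L v γ₀).unit, (![ϖ, (σu ϖ)⁻¹] : Fin 2 → (LocalRing L v)ˣ) 1] with he
  have e0 : ((e 0 : (LocalRing L v)ˣ) : LocalRing L v) = (ϖ : LocalRing L v) := rfl
  have e1 : ((e 1 : (LocalRing L v)ˣ) : LocalRing L v) = 1 := hu1
  have e2 : ((e 2 : (LocalRing L v)ˣ) : LocalRing L v) = (((σu ϖ)⁻¹ : (LocalRing L v)ˣ) : LocalRing L v) := rfl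
  have hreg : ∀ i j : Fin 3, i ≠ j → IsUnit (((e i : (LocalRing L v)ˣ) : LocalRing L v) - ((e j : (LocalRing L v)ˣ) : LocalRing L v)) := by
    intro i j hij
    refine F0P3cStCharTSWeylHypCM.isUnit_of_forall_apply_ne_zero L v _ fun w => ?_
    rw [Pi.sub_apply]
    refine F0P3cStCharTSWeylHypCM.sub_ne_zero_of_valued_ne L v ?_
    have h01 : Valued.v (((e 0 : (LocalRing L v)ˣ) : LocalRing L v) w) ≠ Valued.v (((e 1 : (LocalRing L v)ˣ) : LocalRing L v) w) := by
      rw [e0, e1, hval0, Pi.one_apply, map_one]; exact hm1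
    have h02 : Valued.v (((e 0 : (LocalRing L v)ˣ) : LocalRing L v) w) ≠ Valued.v (((e 2 : (LocalRing L v)ˣ) : LocalRing L v) w) := by
      rw [e0, e2, hval0, hval2]; exact hmp
    have h12 : Valued.v (((e 1 : (LocalRing L v)ˣ) : LocalRing L v) w) ≠ Valued.v (((e 2 : (LocalRing L v)ˣ) : LocalRing L v) w) := by
      rw [e1, e2, Pi.one_apply, map_one, hval2]; exact hp1.symm
    fin_cases i <;> fin_cases j
    · exact absurd rfl hij
    · exact h01
    · exact h02
    · exact h01.symm
    · exact absurd rfl hij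
    · exact h12
    · exact h02.symm
    · exact h12.symm
    · exact absurd rfl hij
  have hG : IsLocalGRegular L v γ₀ := isLocalGRegular_of_fst_eq_glDiagonal L v γ₀ hd' hreg
  -- the centraliser: `Z_{H₂}(t) = M₂`, `Z_H((t, 1)) = M₂ × ⊤`
  have hreg2 : IsRegularElt ((t : ↥(unitaryGroupOfForm (conjLocal L (IsCMField.complexConj L) v) (cmLocalForm L 2 v))) : GL (Fin 2) (LocalRing L v)) :=
    (isRegularElt_fst_snd_of_isLocalGRegular L v γ₀ hG).1
  have hZ₂ : Subgroup.centralizer ({(t : ↥(unitaryGroupOfForm (conjLocal L (IsCMField.complexConj L) v) (cmLocalForm L 2 v)))} :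
      Set ↥(unitaryGroupOfForm (conjLocal L (IsCMField.complexConj L) v) (cmLocalForm L 2 v))) = (cmBorelTriple L 2 v).M := by
    exact F0P3cStCharTSWeylHypFibre.centralizer_eq_torusU_of_isRegularElt (conjLocal L (IsCMField.complexConj L) v) (cmLocalForm L 2 v) t.2 hreg2
  -- `U(Φ₁)(L⁺_v)` is commutative (`1 × 1` matrices over the commutative `∏_{w ∣ v} L_w`; inline as in ★ `cartanEllH_of_cartanFin_two`)
  have hcomm : ∀ a b : (UnitaryGroup.cmDatum L 1 (Matrix.of fun i j : Fin 1 => if i.val + j.val + 1 = 1 then (1 : L) else 0)).Local v, a * b = b * a := by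
    intro a b
    apply Subtype.ext
    apply Units.ext
    change (a.val : GL (Fin 1) (UnitaryGroup.LocalRing L v)).val * (b.val : GL (Fin 1) (UnitaryGroup.LocalRing L v)).val =
      (b.val : GL (Fin 1) (UnitaryGroup.LocalRing L v)).val * (a.val : GL (Fin 1) (UnitaryGroup.LocalRing L v)).val
    ext i j
    obtain rfl : i = 0 := Subsingleton.elim _ _
    obtain rfl : j = 0 := Subsingleton.elim _ _
    simp only [Matrix.mul_apply, Fin.sum_univ_one]
    exact mul_comm _ _
  refine ⟨γ₀, hG, t.2, rfl, ?_⟩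
  rw [hγ₀, centralizer_singleton_prod_eq_prod_top hcomm, ha₀]
  exact congrArg (fun S => Subgroup.prod S ⊤) hZ₂

/-! ## §3 (t3) `M₂` and `M_H` are NOT compact; a compact subgroup of `H_v` is not conjugate to `M_H` -/

/-- **(t3) `M₂ ≅ E_vˣ` IS NOT COMPACT**: the elements `diag(ϖ⁻ⁿ, σ(ϖ)ⁿ) ∈ M₂` have `|d₀|_w = q^n`, unbounded, while `t ↦ |(t₀₀)_w|_w` is continuous on `M₂`.  The rank-2 twin of
★ `F0P3cStCharTSCartanFields.not_isCompact_cmTorus`. [cite: Rogawski1990, §3.6 p. 28; §12.2 p. 173] [cite: PlatonovRapinchuk1994, §3.3] -/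
theorem not_isCompact_splitTorus_two :
    ¬ IsCompact (((cmBorelTriple L 2 v).M : Subgroup ↥(unitaryGroupOfForm (conjLocal L (IsCMField.complexConj L) v) (cmLocalForm L 2 v))) :
      Set ↥(unitaryGroupOfForm (conjLocal L (IsCMField.complexConj L) v) (cmLocalForm L 2 v))) := by
  intro hK
  obtain ⟨w⟩ := (inferInstance : Nonempty (PlacesOver L v))
  obtain ⟨ϖ, hϖ⟩ := F0P3cStCharTSTorusRay.exists_uniformizer_units L v
  -- the continuous size function `t ↦ |d₀(t)_w|_w` on `M₂`
  set f : ↥(cmBorelTriple L 2 v).M → ℝ≥0 := fun t =>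
    normAbs (w.1.adicCompletion L) (((torusEntry (conjLocal L (IsCMField.complexConj L) v) (cmLocalForm L 2 v) 0 t : (LocalRing L v)ˣ) : LocalRing L v) w)
    with hf
  have hfc : Continuous f :=
    LocalFieldHaar.continuous_normAbs.comp ((continuous_apply w).comp (continuous_coe_torusEntry_apply _ _ 0))
  haveI : CompactSpace ↥(cmBorelTriple L 2 v).M := isCompact_iff_compactSpace.1 hK
  obtain ⟨B, hB⟩ := (isCompact_range hfc).bddAbove
  have hq1 : normAbs (w.1.adicCompletion L) ((ϖ : LocalRing L v) w) < 1 := by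
    rw [← map_one (normAbs (w.1.adicCompletion L)), ← not_le, normAbs_le_normAbs_iff_valued, map_one, hϖ w, not_le, ← WithZero.exp_zero]
    exact WithZero.exp_lt_exp.2 (by norm_num)
  have hq0 : normAbs (w.1.adicCompletion L) ((ϖ : LocalRing L v) w) ≠ 0 := by
    rw [_root_.map_ne_zero]
    intro h0
    have h := hϖ w
    rw [h0, map_zero] at h
    exact WithZero.zero_ne_coe h
  set q := normAbs (w.1.adicCompletion L) ((ϖ : LocalRing L v) w) with hq
  have hinv : normAbs (w.1.adicCompletion L) (((ϖ⁻¹ : (LocalRing L v)ˣ) : LocalRing L v) w) = q⁻¹ := by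
    refine eq_inv_of_mul_eq_one_left ?_
    rw [← map_mul, ← Pi.mul_apply, ← Units.val_mul, inv_mul_cancel, Units.val_one, Pi.one_apply, map_one]
  have hval : ∀ n : ℕ, ∃ t : ↥(cmBorelTriple L 2 v).M, f t = q⁻¹ ^ n := by
    intro n
    obtain ⟨t, -, ht0, -⟩ := exists_mem_splitTorus_two L v (ϖ⁻¹ ^ n)
    refine ⟨t, ?_⟩
    rw [hf]
    simp only [ht0, Units.val_pow_eq_pow_val, Pi.pow_apply, map_pow, hinv]
  have hlt : 1 < q⁻¹ := one_lt_inv_iff₀.2 ⟨pos_iff_ne_zero.2 hq0, hq1⟩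
  obtain ⟨n, hn⟩ := (tendsto_pow_atTop_atTop_of_one_lt hlt).eventually_gt_atTop B |>.exists
  obtain ⟨t, ht⟩ := hval n
  have hle : q⁻¹ ^ n ≤ B := by
    rw [← ht]
    exact hB ⟨_, rfl⟩
  exact (not_lt.2 hle) hn

/-- **`M_H = M₂ × U(Φ₁)(L⁺_v)` IS NOT COMPACT** (`v` non-split, so that `U(Φ₁)(L⁺_v)` is compact and ★ `isCompact_coe_prod_top_iff` reads `M_H` compact ↔ `M₂` compact).
[cite: Rogawski1990, §3.6 pp. 28–31] [cite: PlatonovRapinchuk1994, §3.3, §6.2] -/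
theorem not_isCompact_splitTorusH (hns : ∀ w : PlacesOver L v, IsCMField.complexConj L • w.1 = w.1) :
    ¬ IsCompact ((Subgroup.prod (G := (UnitaryGroup.cmDatum L 2 (Matrix.of fun i j : Fin 2 => if i.val + j.val + 1 = 2 then (1 : L) else 0)).Local v) (N := (UnitaryGroup.cmDatum L 1 (Matrix.of fun i j : Fin 1 => if i.val + j.val + 1 = 1 then (1 : L) else 0)).Local v) (cmBorelTriple L 2 v).M ⊤) :
      Set ((UnitaryGroup.cmDatum L 2 (Matrix.of fun i j : Fin 2 => if i.val + j.val + 1 = 2 then (1 : L) else 0)).Local v ×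
        (UnitaryGroup.cmDatum L 1 (Matrix.of fun i j : Fin 1 => if i.val + j.val + 1 = 1 then (1 : L) else 0)).Local v)) := by
  obtain ⟨w⟩ : Nonempty (PlacesOver L v) := inferInstance
  haveI : CompactSpace ((UnitaryGroup.cmDatum L 1 (Matrix.of fun i j : Fin 1 => if i.val + j.val + 1 = 1 then (1 : L) else 0)).Local v) :=
    compactSpace_cmDatum_local_one_of_smul_eq L v w (hns w)
  rw [isCompact_coe_prod_top_iff]
  exact not_isCompact_splitTorus_two L v

/-- **A COMPACT subgroup of `H_v` is not conjugate to `M_H`** (conjugation is a homeomorphism, ★ `isCompact_coe_map_conj_iff`; `M_H` is not compact).  The rank-2 twin of ★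
`F0P3cStCharTSCartanReps.not_conj_cmTorus_of_isCompact`, in the `Subgroup.map (MulAut.conj x)` letters of ★ `exists_cartanAll`. [cite: Rogawski1990, §3.6 pp. 28–31; §12.5 p. 184] -/
theorem not_conj_splitTorusH_of_isCompact (hns : ∀ w : PlacesOver L v, IsCMField.complexConj L • w.1 = w.1)
    {T : Subgroup ((UnitaryGroup.cmDatum L 2 (Matrix.of fun i j : Fin 2 => if i.val + j.val + 1 = 2 then (1 : L) else 0)).Local v ×
        (UnitaryGroup.cmDatum L 1 (Matrix.of fun i j : Fin 1 => if i.val + j.val + 1 = 1 then (1 : L) else 0)).Local v)}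
    (hT : IsCompact (T : Set ((UnitaryGroup.cmDatum L 2 (Matrix.of fun i j : Fin 2 => if i.val + j.val + 1 = 2 then (1 : L) else 0)).Local v ×
        (UnitaryGroup.cmDatum L 1 (Matrix.of fun i j : Fin 1 => if i.val + j.val + 1 = 1 then (1 : L) else 0)).Local v))) :
    (¬ ∃ x : (UnitaryGroup.cmDatum L 2 (Matrix.of fun i j : Fin 2 => if i.val + j.val + 1 = 2 then (1 : L) else 0)).Local v ×
          (UnitaryGroup.cmDatum L 1 (Matrix.of fun i j : Fin 1 => if i.val + j.val + 1 = 1 then (1 : L) else 0)).Local v,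
        T.map (MulAut.conj x).toMonoidHom = (Subgroup.prod (G := (UnitaryGroup.cmDatum L 2 (Matrix.of fun i j : Fin 2 => if i.val + j.val + 1 = 2 then (1 : L) else 0)).Local v) (N := (UnitaryGroup.cmDatum L 1 (Matrix.of fun i j : Fin 1 => if i.val + j.val + 1 = 1 then (1 : L) else 0)).Local v) (cmBorelTriple L 2 v).M ⊤)) ∧
    (¬ ∃ x : (UnitaryGroup.cmDatum L 2 (Matrix.of fun i j : Fin 2 => if i.val + j.val + 1 = 2 then (1 : L) else 0)).Local v ×
          (UnitaryGroup.cmDatum L 1 (Matrix.of fun i j : Fin 1 => if i.val + j.val + 1 = 1 then (1 : L) else 0)).Local v,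
        (Subgroup.prod (G := (UnitaryGroup.cmDatum L 2 (Matrix.of fun i j : Fin 2 => if i.val + j.val + 1 = 2 then (1 : L) else 0)).Local v) (N := (UnitaryGroup.cmDatum L 1 (Matrix.of fun i j : Fin 1 => if i.val + j.val + 1 = 1 then (1 : L) else 0)).Local v) (cmBorelTriple L 2 v).M ⊤).map (MulAut.conj x).toMonoidHom = T) := by
  constructor
  · rintro ⟨x, hx⟩
    exact not_isCompact_splitTorusH L v hns (hx ▸ (isCompact_coe_map_conj_iff T x).2 hT)
  · rintro ⟨x, hx⟩
    exact not_isCompact_splitTorusH L v hns ((isCompact_coe_map_conj_iff _ x).1 (hx ▸ hT))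

end Summit.HodgeConjecture.HodgeConjecture.Cruxes.H413.F0P3cStCharTSCartanSplitTwoH

end
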